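import Summits.Ventures.QEC.Census.Kernel.TB_l5m15_A0_0_0_1_1_4_B0_0_0_2_1_8.Distance
import Summits.Ventures.QEC.Census.Kernel.TB_l6m6_A0_0_0_1_1_1_2_2_B0_0_0_1_1_1_3_5.Distance
import Summits.Ventures.QEC.Census.BB.BBRows
import Summits.Ventures.QEC.Census.BB.Claims
import Literature.InformationTheory.QuantumCodes.TwoBlockConnectedComponents
import Literature.InformationTheory.QuantumCodes.TwoBlockToricLayout
import Literature.InformationTheory.QuantumCodes.TwoBlockWheelComponents
import Literature.InformationTheory.QuantumCodes.TwoBlockRootParameters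
import HarnessLib
import HarnessLib.Audit.Tags

/-!
# Census rows as TYPED two-block codes `QC(A, B)` on `ℤ_ℓ × ℤ_m` — bridge batch `KernelRowsQC05` (2 row(s), kernel tier)

Family: abelian two-block over ℤ_ℓ × ℤ_m (qec census one-module KERNEL-std rows: qec-search-7 certificate modules, MITM and
Brouwer–Zimmermann/automorphism formats). For each census row below (an EXPLICIT matrix code
`cert.code _ = CSSCode.ofMatrices (rowMatrix n cert.HX) (rowMatrix n cert.HZ)` with `IsCode n k d` certified in its own module), this file
puts the row's CONSTRUCTION into the kernel statement, as in the pilot `Census/BB/A1s_n144_k32_4addf704QC.lean` (p511732) and the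
gen-4 batches `A1sRowsQC1–5` / `TwoBGARowsQC1–4`: monomial lists `la`, `lb` (from the certificate's construction record — the
docstring's `A_terms`/`B_terms` or the census row id `2bga-lℓmm-A…-B…`, monomials `xⁱyʲ` as `[i,j]`, convention of BCGMRY24 §4 =
`BivariateBicycleCodes.lean`; the index identity was ALSO re-verified row-for-row by the emitter before filing), the typed object
`qc : BB.Code ℓ m := ⟨polyL la, polyL lb⟩`, the kernel INDEX IDENTITIES `cert.HX = BBRows.rowsX la lb`, `cert.HZ = BBRows.rowsZ la lb`
(`decide`; verified row generator `Census/BB/BBRows.lean`, p502918), the flat identities via `BBRows.rowMatrix_rowsX/Z`, the transport of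
the row's own `dZ_eq` and `k` (its `k_eq`, or the `k`-component of its `isCode`) by type-05's `BB.Code.dZ_eq_of_flat` / `k_eq_of_flat` to
`qc_hasParams : BB.HasParams qc n k d` (census predicate of family BB, `Census/BB/Claims.lean`, distance EXACT) and
`qc_isCode : qc.css.IsCode n k d`; and the census LAYOUT columns (Bravyi et al. 2024 §4 — arXiv:2308.07915: Lemma 2 p0010 L49, Lemma 3 p0011 L9, Lemma 4 p0011 L28; locators per qec-ref-2 2026-08-27T10:27Z) as KERNEL verdicts: «connected» —
`qc_tannerGraph_connected` (Lemma 3, `BB.Code.tannerGraph_connected_of_unit_mem`, explicit multiples of exponent differences) or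
`qc_tannerGraph_not_connected` + `card_expDiffSubgroup` + `qc_card_connectedComponent` (`⟨S⟩` = an explicit finite carrier `diffList`,
both inclusions certified; exact component count by Lemma 3 (ii), `BB.Code.card_connectedComponent_mul_card`; by the tree's connected
normal form `TwoBlockConnectedComponents.lean` such a code is the disjoint union of that many copies of its root code, whose parameters
`[[n/c, k/c, d]]` and connectedness are certified here as `root_isCode` via `TwoBlockRootParameters.lean`); «toric layout» —
`qc_hasToricLayoutWith μ λ` (Lemma 4, `BB.Code.hasToricLayoutWith_of_exponents`; omitted when its sufficient condition has no witness);
«wheel layers» — `qc_wheel_layers` (Lemma 2 minus planarity, `BB.Code.exists_wheel_layers`, weight-(3,3) rows only):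

* `TB_l5m15_A0_0_0_1_1_4_B0_0_0_2_1_8` = `QC(1 + y + xy^4, 1 + y^2 + xy^8)` on `ℤ_5 × ℤ_15`: `[[150, 8, 12]]`; Tanner graph connected; toric layout (15,5); wheel layers 10/30
* `TB_l6m6_A0_0_0_1_1_1_2_2_B0_0_0_1_1_1_3_5` = `QC(1 + y + xy + x^2y^2, 1 + y + xy + x^3y^5)` on `ℤ_6 × ℤ_6`: `[[72, 2, 12]]`; Tanner graph connected; toric layout (6,6)

No new certificate — tier KERNEL, axioms standard, no `native_decide`. HONEST FRAMING: identifies already-certified census objects with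
named algebraic constructions and decides structural (graph) properties; the census comparator columns (printed values, optimality
words) are not touched; for disconnected rows the root code is identified abstractly over `↥⟨S⟩` (not re-indexed to a named `QC(A',B')`,
not identified with a smaller census row); planarity/thickness is not asserted. Generated by
qec-type-05 gen 6's `tools/emit_qc_bridge3.py` (gen 5's emitter + sibling-data rows + ℓ = 1 connectivity) + `tools/conn_cert.py` (HOME/lean/type-05/tools/).
-/

namespace Summit.Ventures.QEC.Census.TB_l5m15_A0_0_0_1_1_4_B0_0_0_2_1_8

open Matrix Literature.InformationTheory.QuantumCodes BBRows

/-- Monomials of `A = 1 + y + xy^4` (construction `A_terms = [[0, 0], [0, 1], [1, 4]]`, from the census row id `2bga-l5m15-A0-0.0-1.1-4-B0-0.0-2.1-8` named in the row module). DATA. -/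
def la : List (BB.Mono 5 15) := [(Fin.ofNat 5 0, Fin.ofNat 15 0), (Fin.ofNat 5 0, Fin.ofNat 15 1), (Fin.ofNat 5 1, Fin.ofNat 15 4)]

/-- Monomials of `B = 1 + y^2 + xy^8` (construction `B_terms = [[0, 0], [0, 2], [1, 8]]`). DATA. -/
def lb : List (BB.Mono 5 15) := [(Fin.ofNat 5 0, Fin.ofNat 15 0), (Fin.ofNat 5 0, Fin.ofNat 15 2), (Fin.ofNat 5 1, Fin.ofNat 15 8)]

/-- The census row's code as a TYPED two-block code `QC(1 + y + xy^4, 1 + y^2 + xy^8)` on `ℤ_5 × ℤ_15` (`BB.Code 5 15`). (definition) -/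
def qc : BB.Code 5 15 := ⟨polyL la, polyL lb⟩

set_option maxRecDepth 100000 in
/-- INDEX IDENTITY, `X` side, in the kernel: the certificate's `H^X` rows ARE the `X`-check words of `qc` (`decide +kernel`). -/
theorem HX_eq_rowsX : TB_l5m15_A0_0_0_1_1_4_B0_0_0_2_1_8.cert.HX = rowsX la lb := by
  decide +kernel

set_option maxRecDepth 100000 in
/-- INDEX IDENTITY, `Z` side. -/
theorem HZ_eq_rowsZ : TB_l5m15_A0_0_0_1_1_4_B0_0_0_2_1_8.cert.HZ = rowsZ la lb := by
  decide +kernel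

set_option maxRecDepth 100000 in
/-- The certificate's flat `H^X` is `qc.HXFlat`. -/
theorem rowMatrix_HX_eq : rowMatrix 150 TB_l5m15_A0_0_0_1_1_4_B0_0_0_2_1_8.cert.HX = qc.HXFlat := by
  have cast : ∀ {H H' : List ℕ} (e : H = H'),
      rowMatrix 150 H = (rowMatrix 150 H').submatrix (Fin.cast (congrArg List.length e)) id := by
    intro H H' e; subst e; rfl
  exact (cast HX_eq_rowsX).trans (rowMatrix_rowsX qc (LA := la) (LB := lb) rfl rfl)

set_option maxRecDepth 100000 in
/-- The certificate's flat `H^Z` is `qc.HZFlat`. -/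
theorem rowMatrix_HZ_eq : rowMatrix 150 TB_l5m15_A0_0_0_1_1_4_B0_0_0_2_1_8.cert.HZ = qc.HZFlat := by
  have cast : ∀ {H H' : List ℕ} (e : H = H'),
      rowMatrix 150 H = (rowMatrix 150 H').submatrix (Fin.cast (congrArg List.length e)) id := by
    intro H H' e; subst e; rfl
  exact (cast HZ_eq_rowsZ).trans (rowMatrix_rowsZ qc (LA := la) (LB := lb) rfl rfl)

set_option maxRecDepth 100000 in
/-- `d^Z (qc) = 12`, transported from the census certificate (`TB_l5m15_A0_0_0_1_1_4_B0_0_0_2_1_8.dZ_eq`) by `BB.Code.dZ_eq_of_flat`. -/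
theorem qc_dZ : qc.css.dZ = 12 :=
  (qc.dZ_eq_of_flat (D := TB_l5m15_A0_0_0_1_1_4_B0_0_0_2_1_8.cert.code (TB_l5m15_A0_0_0_1_1_4_B0_0_0_2_1_8.cert.commOK_of_checkStructure TB_l5m15_A0_0_0_1_1_4_B0_0_0_2_1_8.checkStructure_ok))
    rowMatrix_HX_eq rowMatrix_HZ_eq).symm.trans TB_l5m15_A0_0_0_1_1_4_B0_0_0_2_1_8.dZ_eq

set_option maxRecDepth 100000 in
/-- `k (qc) = 8`, transported from the census certificate (the `k`-component of `TB_l5m15_A0_0_0_1_1_4_B0_0_0_2_1_8.isCode`) by `BB.Code.k_eq_of_flat`. -/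
theorem qc_k : qc.k = 8 :=
  (qc.k_eq_of_flat (D := TB_l5m15_A0_0_0_1_1_4_B0_0_0_2_1_8.cert.code (TB_l5m15_A0_0_0_1_1_4_B0_0_0_2_1_8.cert.commOK_of_checkStructure TB_l5m15_A0_0_0_1_1_4_B0_0_0_2_1_8.checkStructure_ok))
    rowMatrix_HX_eq rowMatrix_HZ_eq).symm.trans TB_l5m15_A0_0_0_1_1_4_B0_0_0_2_1_8.isCode.2.1

/-- **`QC(1 + y + xy^4, 1 + y^2 + xy^8)` on `ℤ_5 × ℤ_15` has parameters `[[150, 8, 12]]`** (distance exact; `BB.HasParams`) — the census row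
`TB_l5m15_A0_0_0_1_1_4_B0_0_0_2_1_8` read as a statement about the construction. KERNEL. -/
theorem qc_hasParams : Summit.Ventures.QEC.BB.HasParams qc 150 8 12 :=
  BB.hasParams_of_dZ (by simp only [BB.numQubits_eq]) qc_k qc_dZ

/-- The same in the generic census vocabulary: `qc.css.IsCode 150 8 12`. -/
theorem qc_isCode : qc.css.IsCode 150 8 12 :=
  (BB.hasParams_iff_isCode (by decide)).1 qc_hasParams

set_option maxRecDepth 100000 in
/-- **The Tanner graph of `qc` is connected** (Bravyi et al. 2024 Lemma 3 / `BB.Code.tannerGraph_connected_of_unit_mem`): `x = (1,0)`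
and `y = (0,1)` are explicit combinations of exponent differences inside `A` or inside `B` (found by qec-type-05's tools/conn_cert.py,
re-checked by `decide`). Census column «connected» for this row, KERNEL. -/
theorem qc_tannerGraph_connected : qc.css.tannerGraph.Connected := by
  refine qc.tannerGraph_connected_of_unit_mem (fun h => absurd (congrFun h ((0 : Fin 5), (0 : Fin 15))) (by decide))
    (fun h => absurd (congrFun h ((0 : Fin 5), (0 : Fin 15))) (by decide)) ?_ ?_
  · have e : (((1 : Fin 5), (0 : Fin 15)) : BB.Mono 5 15) = (4 : ℕ) • ((((0 : Fin 5), (0 : Fin 15))) - (0, 1)) + (14 : ℕ) • ((((0 : Fin 5), (0 : Fin 15))) - (1, 4)) := by decide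
    rw [e]
    exact (AddSubgroup.add_mem _ (AddSubgroup.nsmul_mem _ (qc.sub_mem_expDiffSubgroup_A (by decide) (by decide)) 4) (AddSubgroup.nsmul_mem _ (qc.sub_mem_expDiffSubgroup_A (by decide) (by decide)) 14))
  · have e : (((0 : Fin 5), (1 : Fin 15)) : BB.Mono 5 15) = (14 : ℕ) • ((((0 : Fin 5), (0 : Fin 15))) - (0, 1)) := by decide
    rw [e]
    exact (AddSubgroup.nsmul_mem _ (qc.sub_mem_expDiffSubgroup_A (by decide) (by decide)) 14)

set_option maxRecDepth 100000 in
/-- **`qc` has a toric layout with `(μ, λ) = (15, 5)`** (Bravyi et al. 2024 Lemma 4 / `BB.Code.hasToricLayoutWith_of_exponents`): the two layout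
generators `A_iA_jᵀ ↦ (0, 0) − (0, 1)` and `B_gB_hᵀ ↦ (0, 2) − (1, 8)` generate `ℤ_5 × ℤ_15` generate the group
(explicit multiples giving `x` and `y`) and have orders `15` and `5` (product `75 = ℓm`). — both facts `decide`d as LOCAL
steps (they mention no row constant, so as separate theorems they would restate the same statement across rows). Census
layout column, KERNEL. -/
theorem qc_hasToricLayoutWith : HasToricLayoutWith 15 5 qc.css.tannerGraph := by
  have hgen : AddSubgroup.closure ({((0 : Fin 5), (0 : Fin 15)) - (0, 1), ((0 : Fin 5), (2 : Fin 15)) - (1, 8)} : Set (BB.Mono 5 15)) = ⊤ := by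
    apply BB.Code.addSubgroup_eq_top_of_unit_mem
    · have h1 := AddSubgroup.subset_closure (k := ({((0 : Fin 5), (0 : Fin 15)) - (0, 1), ((0 : Fin 5), (2 : Fin 15)) - (1, 8)} : Set (BB.Mono 5 15))) (Set.mem_insert _ _)
      have h2 := AddSubgroup.subset_closure (k := ({((0 : Fin 5), (0 : Fin 15)) - (0, 1), ((0 : Fin 5), (2 : Fin 15)) - (1, 8)} : Set (BB.Mono 5 15))) (Set.mem_insert_of_mem _ rfl)
      have e : (6 : ℕ) • (((0 : Fin 5), (0 : Fin 15)) - (0, 1)) + (4 : ℕ) • (((0 : Fin 5), (2 : Fin 15)) - (1, 8)) = (1, 0) := by decide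
      have h' := AddSubgroup.add_mem _ (AddSubgroup.nsmul_mem _ h1 6) (AddSubgroup.nsmul_mem _ h2 4)
      rw [e] at h'
      exact h'
    · have h1 := AddSubgroup.subset_closure (k := ({((0 : Fin 5), (0 : Fin 15)) - (0, 1), ((0 : Fin 5), (2 : Fin 15)) - (1, 8)} : Set (BB.Mono 5 15))) (Set.mem_insert _ _)
      have h2 := AddSubgroup.subset_closure (k := ({((0 : Fin 5), (0 : Fin 15)) - (0, 1), ((0 : Fin 5), (2 : Fin 15)) - (1, 8)} : Set (BB.Mono 5 15))) (Set.mem_insert_of_mem _ rfl)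
      have e : (14 : ℕ) • (((0 : Fin 5), (0 : Fin 15)) - (0, 1)) + (0 : ℕ) • (((0 : Fin 5), (2 : Fin 15)) - (1, 8)) = (0, 1) := by decide
      have h' := AddSubgroup.add_mem _ (AddSubgroup.nsmul_mem _ h1 14) (AddSubgroup.nsmul_mem _ h2 0)
      rw [e] at h'
      exact h'
  have hord : addOrderOf (((0 : Fin 5), (0 : Fin 15)) - (0, 1)) = 15 ∧ addOrderOf (((0 : Fin 5), (2 : Fin 15)) - (1, 8)) = 5 :=
    ⟨(addOrderOf_eq_iff (by norm_num)).mpr (by decide), (addOrderOf_eq_iff (by norm_num)).mpr (by decide)⟩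
  have h := qc.hasToricLayoutWith_of_exponents (g := ((0 : Fin 5), (0 : Fin 15))) (g' := (0, 1))
    (h := ((0 : Fin 5), (2 : Fin 15))) (h' := (1, 8)) (by decide) (by decide) (by decide) (by decide)
    hgen (by rw [hord.1, hord.2])
  rwa [hord.1, hord.2] at h

/-- `qc` has a toric layout. KERNEL. -/
theorem qc_hasToricLayout : HasToricLayout qc.css.tannerGraph :=
  ⟨15, 5, by norm_num, by norm_num, qc_hasToricLayoutWith⟩

set_option maxRecDepth 100000 in
/-- **`qc`**: Tanner graph = edge-disjoint union of two layers whose components are wheel graphs `prismGraph 10` (`A₃A₂ᵀ` of order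
`5`) and `prismGraph 30` (`B₂B₁ᵀ` of order `15`) — BCGMRY24 Lemma 2 minus planarity (`BB.Code.exists_wheel_layers`). KERNEL. -/
theorem qc_wheel_layers :
    ∃ ΓA ΓB : SimpleGraph ((BB.Mono 5 15 ⊕ BB.Mono 5 15) ⊕ (BB.Mono 5 15 ⊕ BB.Mono 5 15)),
    qc.css.tannerGraph = ΓA ⊔ ΓB ∧ Disjoint ΓA ΓB ∧
    (∀ K : ΓA.ConnectedComponent, Nonempty (K.toSimpleGraph ≃g prismGraph 10)) ∧
    (∀ K : ΓB.ConnectedComponent, Nonempty (K.toSimpleGraph ≃g prismGraph 30)) := by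
  have hA : ∀ g : BB.Mono 5 15, qc.A g ≠ 0 ↔ g = ((0 : Fin 5), (0 : Fin 15)) ∨ g = ((0 : Fin 5), (1 : Fin 15)) ∨ g = ((1 : Fin 5), (4 : Fin 15)) := by decide +kernel
  have hB : ∀ g : BB.Mono 5 15, qc.B g ≠ 0 ↔ g = ((0 : Fin 5), (0 : Fin 15)) ∨ g = ((0 : Fin 5), (2 : Fin 15)) ∨ g = ((1 : Fin 5), (8 : Fin 15)) := by decide +kernel
  have h := qc.exists_wheel_layers (g₁ := ((0 : Fin 5), (0 : Fin 15))) (g₂ := ((0 : Fin 5), (1 : Fin 15))) (g₃ := ((1 : Fin 5), (4 : Fin 15))) (h₁ := ((0 : Fin 5), (0 : Fin 15)))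
    (h₂ := ((0 : Fin 5), (2 : Fin 15))) (h₃ := ((1 : Fin 5), (8 : Fin 15))) (by decide) (by decide) (by decide) (by decide) (by decide) (by decide) hA hB
  have e1 : addOrderOf (((1 : Fin 5), (4 : Fin 15)) - (0, 1)) = 5 := (addOrderOf_eq_iff (by norm_num)).mpr (by decide)
  have e2 : addOrderOf (((0 : Fin 5), (2 : Fin 15)) - (0, 0)) = 15 := (addOrderOf_eq_iff (by norm_num)).mpr (by decide)
  rw [e1, e2] at h
  exact h

end Summit.Ventures.QEC.Census.TB_l5m15_A0_0_0_1_1_4_B0_0_0_2_1_8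

namespace Summit.Ventures.QEC.Census.TB_l6m6_A0_0_0_1_1_1_2_2_B0_0_0_1_1_1_3_5

open Matrix Literature.InformationTheory.QuantumCodes BBRows

/-- Monomials of `A = 1 + y + xy + x^2y^2` (construction `A_terms = [[0, 0], [0, 1], [1, 1], [2, 2]]`, from the census row id `2bga-l6m6-A0-0.0-1.1-1.2-2-B0-0.0-1.1-1.3-5` named in the row module). DATA. -/
def la : List (BB.Mono 6 6) := [(Fin.ofNat 6 0, Fin.ofNat 6 0), (Fin.ofNat 6 0, Fin.ofNat 6 1), (Fin.ofNat 6 1, Fin.ofNat 6 1), (Fin.ofNat 6 2, Fin.ofNat 6 2)]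

/-- Monomials of `B = 1 + y + xy + x^3y^5` (construction `B_terms = [[0, 0], [0, 1], [1, 1], [3, 5]]`). DATA. -/
def lb : List (BB.Mono 6 6) := [(Fin.ofNat 6 0, Fin.ofNat 6 0), (Fin.ofNat 6 0, Fin.ofNat 6 1), (Fin.ofNat 6 1, Fin.ofNat 6 1), (Fin.ofNat 6 3, Fin.ofNat 6 5)]

/-- The census row's code as a TYPED two-block code `QC(1 + y + xy + x^2y^2, 1 + y + xy + x^3y^5)` on `ℤ_6 × ℤ_6` (`BB.Code 6 6`). (definition) -/
def qc : BB.Code 6 6 := ⟨polyL la, polyL lb⟩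

set_option maxRecDepth 100000 in
/-- INDEX IDENTITY, `X` side, in the kernel: the certificate's `H^X` rows ARE the `X`-check words of `qc` (`decide +kernel`). -/
theorem HX_eq_rowsX : TB_l6m6_A0_0_0_1_1_1_2_2_B0_0_0_1_1_1_3_5.cert.HX = rowsX la lb := by
  decide +kernel

set_option maxRecDepth 100000 in
/-- INDEX IDENTITY, `Z` side. -/
theorem HZ_eq_rowsZ : TB_l6m6_A0_0_0_1_1_1_2_2_B0_0_0_1_1_1_3_5.cert.HZ = rowsZ la lb := by
  decide +kernel

set_option maxRecDepth 100000 in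
/-- The certificate's flat `H^X` is `qc.HXFlat`. -/
theorem rowMatrix_HX_eq : rowMatrix 72 TB_l6m6_A0_0_0_1_1_1_2_2_B0_0_0_1_1_1_3_5.cert.HX = qc.HXFlat := by
  have cast : ∀ {H H' : List ℕ} (e : H = H'),
      rowMatrix 72 H = (rowMatrix 72 H').submatrix (Fin.cast (congrArg List.length e)) id := by
    intro H H' e; subst e; rfl
  exact (cast HX_eq_rowsX).trans (rowMatrix_rowsX qc (LA := la) (LB := lb) rfl rfl)

set_option maxRecDepth 100000 in
/-- The certificate's flat `H^Z` is `qc.HZFlat`. -/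
theorem rowMatrix_HZ_eq : rowMatrix 72 TB_l6m6_A0_0_0_1_1_1_2_2_B0_0_0_1_1_1_3_5.cert.HZ = qc.HZFlat := by
  have cast : ∀ {H H' : List ℕ} (e : H = H'),
      rowMatrix 72 H = (rowMatrix 72 H').submatrix (Fin.cast (congrArg List.length e)) id := by
    intro H H' e; subst e; rfl
  exact (cast HZ_eq_rowsZ).trans (rowMatrix_rowsZ qc (LA := la) (LB := lb) rfl rfl)

set_option maxRecDepth 100000 in
/-- `d^Z (qc) = 12`, transported from the census certificate (`TB_l6m6_A0_0_0_1_1_1_2_2_B0_0_0_1_1_1_3_5.dZ_eq`) by `BB.Code.dZ_eq_of_flat`. -/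
theorem qc_dZ : qc.css.dZ = 12 :=
  (qc.dZ_eq_of_flat (D := TB_l6m6_A0_0_0_1_1_1_2_2_B0_0_0_1_1_1_3_5.cert.code (TB_l6m6_A0_0_0_1_1_1_2_2_B0_0_0_1_1_1_3_5.cert.commOK_of_checkStructure TB_l6m6_A0_0_0_1_1_1_2_2_B0_0_0_1_1_1_3_5.checkStructure_ok))
    rowMatrix_HX_eq rowMatrix_HZ_eq).symm.trans TB_l6m6_A0_0_0_1_1_1_2_2_B0_0_0_1_1_1_3_5.dZ_eq

set_option maxRecDepth 100000 in
/-- `k (qc) = 2`, transported from the census certificate (the `k`-component of `TB_l6m6_A0_0_0_1_1_1_2_2_B0_0_0_1_1_1_3_5.isCode`) by `BB.Code.k_eq_of_flat`. -/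
theorem qc_k : qc.k = 2 :=
  (qc.k_eq_of_flat (D := TB_l6m6_A0_0_0_1_1_1_2_2_B0_0_0_1_1_1_3_5.cert.code (TB_l6m6_A0_0_0_1_1_1_2_2_B0_0_0_1_1_1_3_5.cert.commOK_of_checkStructure TB_l6m6_A0_0_0_1_1_1_2_2_B0_0_0_1_1_1_3_5.checkStructure_ok))
    rowMatrix_HX_eq rowMatrix_HZ_eq).symm.trans TB_l6m6_A0_0_0_1_1_1_2_2_B0_0_0_1_1_1_3_5.isCode.2.1

/-- **`QC(1 + y + xy + x^2y^2, 1 + y + xy + x^3y^5)` on `ℤ_6 × ℤ_6` has parameters `[[72, 2, 12]]`** (distance exact; `BB.HasParams`) — the census row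
`TB_l6m6_A0_0_0_1_1_1_2_2_B0_0_0_1_1_1_3_5` read as a statement about the construction. KERNEL. -/
theorem qc_hasParams : Summit.Ventures.QEC.BB.HasParams qc 72 2 12 :=
  BB.hasParams_of_dZ (by simp only [BB.numQubits_eq]) qc_k qc_dZ

/-- The same in the generic census vocabulary: `qc.css.IsCode 72 2 12`. -/
theorem qc_isCode : qc.css.IsCode 72 2 12 :=
  (BB.hasParams_iff_isCode (by decide)).1 qc_hasParams

set_option maxRecDepth 100000 in
/-- **The Tanner graph of `qc` is connected** (Bravyi et al. 2024 Lemma 3 / `BB.Code.tannerGraph_connected_of_unit_mem`): `x = (1,0)`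
and `y = (0,1)` are explicit combinations of exponent differences inside `A` or inside `B` (found by qec-type-05's tools/conn_cert.py,
re-checked by `decide`). Census column «connected» for this row, KERNEL. -/
theorem qc_tannerGraph_connected : qc.css.tannerGraph.Connected := by
  refine qc.tannerGraph_connected_of_unit_mem (fun h => absurd (congrFun h ((0 : Fin 6), (0 : Fin 6))) (by decide))
    (fun h => absurd (congrFun h ((0 : Fin 6), (0 : Fin 6))) (by decide)) ?_ ?_
  · have e : (((1 : Fin 6), (0 : Fin 6)) : BB.Mono 6 6) = (5 : ℕ) • ((((0 : Fin 6), (1 : Fin 6))) - (1, 1)) := by decide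
    rw [e]
    exact (AddSubgroup.nsmul_mem _ (qc.sub_mem_expDiffSubgroup_A (by decide) (by decide)) 5)
  · have e : (((0 : Fin 6), (1 : Fin 6)) : BB.Mono 6 6) = (5 : ℕ) • ((((0 : Fin 6), (0 : Fin 6))) - (0, 1)) := by decide
    rw [e]
    exact (AddSubgroup.nsmul_mem _ (qc.sub_mem_expDiffSubgroup_A (by decide) (by decide)) 5)

set_option maxRecDepth 100000 in
/-- **`qc` has a toric layout with `(μ, λ) = (6, 6)`** (Bravyi et al. 2024 Lemma 4 / `BB.Code.hasToricLayoutWith_of_exponents`): the two layout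
generators `A_iA_jᵀ ↦ (0, 0) − (0, 1)` and `B_gB_hᵀ ↦ (0, 0) − (1, 1)` generate `ℤ_6 × ℤ_6` generate the group
(explicit multiples giving `x` and `y`) and have orders `6` and `6` (product `36 = ℓm`). — both facts `decide`d as LOCAL
steps (they mention no row constant, so as separate theorems they would restate the same statement across rows). Census
layout column, KERNEL. -/
theorem qc_hasToricLayoutWith : HasToricLayoutWith 6 6 qc.css.tannerGraph := by
  have hgen : AddSubgroup.closure ({((0 : Fin 6), (0 : Fin 6)) - (0, 1), ((0 : Fin 6), (0 : Fin 6)) - (1, 1)} : Set (BB.Mono 6 6)) = ⊤ := by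
    apply BB.Code.addSubgroup_eq_top_of_unit_mem
    · have h1 := AddSubgroup.subset_closure (k := ({((0 : Fin 6), (0 : Fin 6)) - (0, 1), ((0 : Fin 6), (0 : Fin 6)) - (1, 1)} : Set (BB.Mono 6 6))) (Set.mem_insert _ _)
      have h2 := AddSubgroup.subset_closure (k := ({((0 : Fin 6), (0 : Fin 6)) - (0, 1), ((0 : Fin 6), (0 : Fin 6)) - (1, 1)} : Set (BB.Mono 6 6))) (Set.mem_insert_of_mem _ rfl)
      have e : (1 : ℕ) • (((0 : Fin 6), (0 : Fin 6)) - (0, 1)) + (5 : ℕ) • (((0 : Fin 6), (0 : Fin 6)) - (1, 1)) = (1, 0) := by decide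
      have h' := AddSubgroup.add_mem _ (AddSubgroup.nsmul_mem _ h1 1) (AddSubgroup.nsmul_mem _ h2 5)
      rw [e] at h'
      exact h'
    · have h1 := AddSubgroup.subset_closure (k := ({((0 : Fin 6), (0 : Fin 6)) - (0, 1), ((0 : Fin 6), (0 : Fin 6)) - (1, 1)} : Set (BB.Mono 6 6))) (Set.mem_insert _ _)
      have h2 := AddSubgroup.subset_closure (k := ({((0 : Fin 6), (0 : Fin 6)) - (0, 1), ((0 : Fin 6), (0 : Fin 6)) - (1, 1)} : Set (BB.Mono 6 6))) (Set.mem_insert_of_mem _ rfl)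
      have e : (5 : ℕ) • (((0 : Fin 6), (0 : Fin 6)) - (0, 1)) + (0 : ℕ) • (((0 : Fin 6), (0 : Fin 6)) - (1, 1)) = (0, 1) := by decide
      have h' := AddSubgroup.add_mem _ (AddSubgroup.nsmul_mem _ h1 5) (AddSubgroup.nsmul_mem _ h2 0)
      rw [e] at h'
      exact h'
  have hord : addOrderOf (((0 : Fin 6), (0 : Fin 6)) - (0, 1)) = 6 ∧ addOrderOf (((0 : Fin 6), (0 : Fin 6)) - (1, 1)) = 6 :=
    ⟨(addOrderOf_eq_iff (by norm_num)).mpr (by decide), (addOrderOf_eq_iff (by norm_num)).mpr (by decide)⟩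
  have h := qc.hasToricLayoutWith_of_exponents (g := ((0 : Fin 6), (0 : Fin 6))) (g' := (0, 1))
    (h := ((0 : Fin 6), (0 : Fin 6))) (h' := (1, 1)) (by decide) (by decide) (by decide) (by decide)
    hgen (by rw [hord.1, hord.2])
  rwa [hord.1, hord.2] at h

/-- `qc` has a toric layout. KERNEL. -/
theorem qc_hasToricLayout : HasToricLayout qc.css.tannerGraph :=
  ⟨6, 6, by norm_num, by norm_num, qc_hasToricLayoutWith⟩

end Summit.Ventures.QEC.Census.TB_l6m6_A0_0_0_1_1_1_2_2_B0_0_0_1_1_1_3_5
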